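import Mathlib
import HarnessLib.Audit
import Summits.PneNP.PneNP.Theorems.PstarUnionRankSixBridge
import Summits.PneNP.PneNP.Theorems.PstarRankRigidity

/-!
# Rank-six vacuity of Case A: no union-terminal configuration has `rank q ≥ 6` (ROUND-24, memo §14.16–§14.18, CASE A MASTER PLAN STEP 1)

FRONTIER range-avoidance ladder, rung F-N3, ROUND 24 (cell `pnp-ideate`, planner memo `r24/CORE-BOUND-NOTES.md` §14.16–§14.18, CASE A MASTER PLAN of planner p3 g22
(STATUS 19:09:48Z / 19:24:00Z), STEP 1 "rank-six vacuity"; restricted-model proof complexity — nothing here bears on `P` versus `NP`).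

Setting (`PstarUnionRankSixBridge`): well-formed liftable bridge data `B` = (core `J₀`, chords `N`, reader `A₀ = (C₁, G₁, b₁)` with join `T₁`, shared constraint
`w₂ = (C₂, G₂, b₂)` with join `T₂`), a second reader `A₁ = (C₁′, G₁, b₁′)` agreeing with `C₁` on the XOR vertices, monomials off the chord privates (hun), `w₂` blind on
the privates (Case A), both pairs unsolvable over `J₀` (T3) and the UNION COVER (M0′): every output of `J₀` releases one of the two pairs.  `q := free₂ + b₂` is the
second constraint on the cube, polar form `freePolar I N T₂ G₂`.

* `exists_zero` — `q` has a zero (rank `≥ 4`);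
* `chord_EQ` — **every chord is (EQ)**: `Q_{D c} = q + κ_c` ((★★) `u_c ≡ 1` on `Z(q)` + kernel triviality; a constant `Q_{D c}` would have polar form `0 = polar ∅`,
  so `D c = ∅`, impossible for a fundamental set);
* `reader_shape` — **the reader is `ε·w₂ + (private reads) + κ` at EVERY assignment**: infeasibility at the all-ON state makes `free₁` constant on `Z(q)`, kernel
  triviality makes it `≡ c` (then `T₁ = ∅` by polar comparison) or `q + κ` (then `T₁ = T₂`), and the evaluation identity converts this into the instance statement;
* `w₂_shape` — for an (EQ) chord `c₀`: `T₂ = D c₀` and `w₂(z) = K + z_{u(c₀)} + z_{v(c₀)}` at every `z`; `privs_on` — so `c₀ ∧ w₂` switches the privates of `c₀` ON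
  (calibrated at a genuine solution with privates ON, `PstarUnionRankSixBridge.exists_solution_privs`);
* `false_of_release`, `caseA_empty_of_kernel_trivial` — **Case A is empty whenever `q` has a zero and trivial kernel** (every quadratic vanishing on `Z(q)` is `0` or
  `q`; planner's form 19:54:21Z / 19:59:12Z): a release witness of a forest output (one exists: `D c₀ ≠ ∅`, or `J₀ ≠ ∅` when `N = ∅`) gives the released reader its value
  on `Z`, which is not its target — contradiction; `caseA_rank_six_empty` — **STEP 1**, the rank-six instance (`PstarRankRigidity.eq_zero_or_eq_of_rank_six`).
  No expansion hypothesis is used; `forcing_of_kernel_trivial` is the abstract form of (R6).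
-/

set_option linter.dupNamespace false -- `Summit.PneNP.PneNP.…`: summit = sub-problem name (D-0017 single-conjunct layout)

open Finset Module Literature.Computability.Complexity
open scoped symmDiff
open Summit.PneNP.PneNP.Theorems.PstarFibrePolys (bit bit_injective)
open Summit.PneNP.PneNP.Theorems.PstarTyped (Typed)
open Summit.PneNP.PneNP.Theorems.PstarSALevel (SimpleOverlap)
open Summit.PneNP.PneNP.Theorems.PstarGapOneAll (gval)
open Summit.PneNP.PneNP.Theorems.PstarXCore (xverts)
open Summit.PneNP.PneNP.Theorems.PstarCubeIdeals (IsQuadFn)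
open Summit.PneNP.PneNP.Theorems.PstarProductRank (qform polar polar_apply)
open Summit.PneNP.PneNP.Theorems.PstarQuadRank (rad)
open Summit.PneNP.PneNP.Theorems.PstarForcing (exists_ne_of_rank_four polar_unique)
open Summit.PneNP.PneNP.Theorems.PstarChordBridgeTools
open Summit.PneNP.PneNP.Theorems.PstarChordBridge
open Summit.PneNP.PneNP.Theorems.PstarChordBridgeFundamental (two_le_card_of_even)
open Summit.PneNP.PneNP.Theorems.PstarChordBridgeForcing (freeMon freePolar free_add sys_q_add gam sys_u_eq qform_add')
open Summit.PneNP.PneNP.Theorems.PstarRankRigidity (eq_zero_or_eq_of_rank_six)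
open Summit.PneNP.PneNP.Theorems.PstarUnionRankSixBridge

namespace Summit.PneNP.PneNP.Theorems.PstarUnionRankSixEmpty

variable {n m : ℕ}

/-- Every element of `𝔽₂` is `0` or `1`. -/
private theorem zmod2_cases (t : ZMod 2) : t = 0 ∨ t = 1 := by
  revert t; decide

/-- In `𝔽₂`, `x + x = 0`. -/
private theorem zmod2_add_self (x : ZMod 2) : x + x = 0 := by
  revert x; decide

/-- In `𝔽₂`, `s + t = 0 ↔ s = t`. -/
private theorem zmod2_add_eq_zero_iff (s t : ZMod 2) : s + t = 0 ↔ s = t := by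
  revert s t; decide

/-! ## Forcing from kernel triviality -/

section kernel

variable {M : Type*} [AddCommGroup M] [Module (ZMod 2) M]

/-- **Forcing from kernel triviality.**  If every quadratic `g` vanishing on `Z(q) = {q = 0}` is `0` or `q` (the kernel `K(q)` is trivial), then every quadratic `f`
constant `= c` on `Z(q)` is `≡ c` or `q + κ` (apply the hypothesis to `g := f + c`; cf. `PstarUnionRankSix.forcing_trivial_of_rank_six`, the rank-six instance). -/
theorem forcing_of_kernel_trivial {q f : M → ZMod 2}
    (hK : ∀ g : M → ZMod 2, IsQuadFn g → (∀ x, q x = 0 → g x = 0) → (∀ x, g x = 0) ∨ (∀ x, g x = q x))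
    (hf : IsQuadFn f) {c : ZMod 2} (hconst : ∀ x, q x = 0 → f x = c) :
    (∀ x, f x = c) ∨ (∃ κ : ZMod 2, ∀ x, f x = q x + κ) := by
  obtain ⟨B', hB'⟩ := hf
  have hg : IsQuadFn fun x => f x + c := by
    refine ⟨B', fun x w => ?_⟩
    show f (x + w) + c = (f x + c) + (f w + c) + (f 0 + c) + B' x w
    rw [hB' x w]
    linear_combination (-1 : ZMod 2) * zmod2_add_self c
  have hZ : ∀ x, q x = 0 → (fun x => f x + c) x = 0 := fun x hx => by
    show f x + c = 0
    rw [hconst x hx, zmod2_add_self c]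
  have back : ∀ x, f x = (f x + c) + c := fun x => by rw [add_assoc, zmod2_add_self c, add_zero]
  rcases hK _ hg hZ with h0 | hq
  · left
    intro x
    rw [back x, h0 x, zero_add]
  · right
    refine ⟨c, fun x => ?_⟩
    rw [back x, hq x]

end kernel

/-! ## The second constraint `q = free₂ + b₂` -/

/-- The polar identity of `q = free₂ + b₂` (`PstarChordBridgeForcing.sys_q_add`, unfolded). -/
theorem q_polar (I : LocalMap 4 n m) (B : BridgeData n m) (x w : Fin n → ZMod 2) :
    free I B.y (B.J₀ \ B.N) B.N B.T₂ B.C₂ B.G₂ (x + w) + bit B.b₂ =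
      (free I B.y (B.J₀ \ B.N) B.N B.T₂ B.C₂ B.G₂ x + bit B.b₂) + (free I B.y (B.J₀ \ B.N) B.N B.T₂ B.C₂ B.G₂ w + bit B.b₂)
        + (free I B.y (B.J₀ \ B.N) B.N B.T₂ B.C₂ B.G₂ 0 + bit B.b₂) + freePolar I B.N B.T₂ B.G₂ x w :=
  sys_q_add I B x w

/-- **`q` has a zero** as soon as its polar rank is `≥ 4`. -/
theorem exists_zero (I : LocalMap 4 n m) (B : BridgeData n m)
    (hrank : finrank (ZMod 2) (rad (freePolar I B.N B.T₂ B.G₂)) + 4 ≤ finrank (ZMod 2) (Fin n → ZMod 2)) :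
    ∃ a, free I B.y (B.J₀ \ B.N) B.N B.T₂ B.C₂ B.G₂ a = bit B.b₂ := by
  obtain ⟨v, hv⟩ := exists_ne_of_rank_four (Q := fun x => free I B.y (B.J₀ \ B.N) B.N B.T₂ B.C₂ B.G₂ x + bit B.b₂) (q_polar I B) hrank
  rcases zmod2_cases (free I B.y (B.J₀ \ B.N) B.N B.T₂ B.C₂ B.G₂ 0 + bit B.b₂) with h0 | h0
  · exact ⟨0, (zmod2_add_eq_zero_iff _ _).1 h0⟩
  · refine ⟨v, (zmod2_add_eq_zero_iff _ _).1 ?_⟩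
    rcases zmod2_cases (free I B.y (B.J₀ \ B.N) B.N B.T₂ B.C₂ B.G₂ v + bit B.b₂) with h | h
    · exact h
    · exact absurd (h.trans h0.symm) hv

/-! ## Every chord is (EQ) -/

/-- **Every chord is (EQ) in rank six.**  If every chord is forced on `Z(q)` and `q` has polar rank `≥ 6`, then `Q_{D c} = q + κ_c` for every chord `c`. -/
theorem chord_EQ (I : LocalMap 4 n m) (hI : I.IsPure xorAndPred) (hS : SimpleOverlap I) {B : BridgeData n m} (hW : B.WF I)
    (hforced : ∀ e ∈ B.N, ∀ a, free I B.y (B.J₀ \ B.N) B.N B.T₂ B.C₂ B.G₂ a = bit B.b₂ → uval I B.y (B.D e) e a = 1)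
    (hK : ∀ g : (Fin n → ZMod 2) → ZMod 2, IsQuadFn g → (∀ x, free I B.y (B.J₀ \ B.N) B.N B.T₂ B.C₂ B.G₂ x + bit B.b₂ = 0 → g x = 0) →
      (∀ x, g x = 0) ∨ (∀ x, g x = free I B.y (B.J₀ \ B.N) B.N B.T₂ B.C₂ B.G₂ x + bit B.b₂)) {e : Fin m} (he : e ∈ B.N) :
    ∃ κ : ZMod 2, ∀ x, qform (B.D e) (fun j => I.vars j 2) (fun j => I.vars j 3) x =
      free I B.y (B.J₀ \ B.N) B.N B.T₂ B.C₂ B.G₂ x + bit B.b₂ + κ := by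
  classical
  have hconst : ∀ x, free I B.y (B.J₀ \ B.N) B.N B.T₂ B.C₂ B.G₂ x + bit B.b₂ = 0 →
      qform (B.D e) (fun j => I.vars j 2) (fun j => I.vars j 3) x = gam B e + 1 := by
    intro x hx
    have h := hforced e he x ((zmod2_add_eq_zero_iff _ _).1 hx)
    have hu := sys_u_eq I B e x
    rw [sys_u] at hu
    rw [hu] at h
    have e2 : ∀ g Q : ZMod 2, g + Q = 1 → Q = g + 1 := by decide
    exact e2 _ _ h
  rcases forcing_of_kernel_trivial (q := fun x => free I B.y (B.J₀ \ B.N) B.N B.T₂ B.C₂ B.G₂ x + bit B.b₂)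
      (f := qform (B.D e) (fun j => I.vars j 2) (fun j => I.vars j 3)) hK ⟨_, qform_add' I (B.D e)⟩ hconst with hall | hEQ
  · -- a constant `Q_{D e}` has polar form `0 = polar ∅`, so `D e = ∅` — impossible for a fundamental set
    exfalso
    have h0 : ∀ x w, qform (B.D e) (fun j => I.vars j 2) (fun j => I.vars j 3) (x + w) =
        qform (B.D e) (fun j => I.vars j 2) (fun j => I.vars j 3) x + qform (B.D e) (fun j => I.vars j 2) (fun j => I.vars j 3) w
          + qform (B.D e) (fun j => I.vars j 2) (fun j => I.vars j 3) 0
          + (polar (∅ : Finset (Fin m)) (fun j => I.vars j 2) (fun j => I.vars j 3) : LinearMap.BilinForm (ZMod 2) (Fin n → ZMod 2)) x w := by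
      intro x w
      rw [hall, hall, hall, hall, polar_apply, sum_empty]
      generalize gam B e + 1 = t; revert t; decide
    have hD := eq_of_polar_eq I hI hS (polar_unique (qform_add' I (B.D e)) h0)
    have heD : e ∉ B.D e := fun h => (mem_sdiff.1 (hW.hD e he h)).2 he
    have h2 := two_le_card_of_even I hI hS heD (hW.hDeven e he)
    rw [hD, card_empty] at h2
    omega
  · exact hEQ

/-! ## The shape of a reader -/

/-- Hun in the form the evaluation identity wants. -/
theorem nopriv_of_hun (I : LocalMap 4 n m) {N G : Finset (Fin m)} (h : ∀ v ∈ privs I N, ∀ g ∈ G, I.vars g 2 ≠ v ∧ I.vars g 3 ≠ v) :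
    ∀ g ∈ G, ¬ (I.vars g 2 ∈ privs I N ∨ I.vars g 3 ∈ privs I N) := by
  rintro g hg (h2 | h3)
  · exact (h _ h2 g hg).1 rfl
  · exact (h _ h3 g hg).2 rfl

/-- The private-free monomials lie among the monomials. -/
theorem freeMon_subset (I : LocalMap 4 n m) (N G : Finset (Fin m)) : freeMon I N G ⊆ G := by
  intro g hg
  unfold PstarChordBridgeForcing.freeMon at hg
  exact (mem_filter.1 hg).1

/-- **The shape of a reader.**  In the setting above (one pair: hun, `w₂` blind, (T3), every chord forced on `Z(q)`, rank `q ≥ 6`) there are `ε, κ ∈ 𝔽₂` with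
`A(z) = ε·w₂(z) + Σ_{v ∈ C₁ ∩ privs} z_v + κ` at EVERY assignment `z`. -/
theorem reader_shape (I : LocalMap 4 n m) (hI : I.IsPure xorAndPred) (hT : Typed I) (hS : SimpleOverlap I) {B : BridgeData n m} (hW : B.WF I)
    (hL : Lift I B) (hG₁ : Disjoint B.G₁ B.J₀) (hG₂ : Disjoint B.G₂ B.J₀)
    (hun : ∀ v ∈ privs I B.N, (∀ g ∈ B.G₁, I.vars g 2 ≠ v ∧ I.vars g 3 ≠ v) ∧ ∀ g ∈ B.G₂, I.vars g 2 ≠ v ∧ I.vars g 3 ≠ v)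
    (hblind : ∀ v ∈ privs I B.N, v ∉ B.C₂) (hT3 : ¬ ∃ z, Solution I B B.J₀ z)
    (hforced : ∀ e ∈ B.N, ∀ a, free I B.y (B.J₀ \ B.N) B.N B.T₂ B.C₂ B.G₂ a = bit B.b₂ → uval I B.y (B.D e) e a = 1)
    (hK : ∀ g : (Fin n → ZMod 2) → ZMod 2, IsQuadFn g → (∀ x, free I B.y (B.J₀ \ B.N) B.N B.T₂ B.C₂ B.G₂ x + bit B.b₂ = 0 → g x = 0) →
      (∀ x, g x = 0) ∨ (∀ x, g x = free I B.y (B.J₀ \ B.N) B.N B.T₂ B.C₂ B.G₂ x + bit B.b₂)) :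
    ∃ ε κ : ZMod 2, ∀ z : Fin n → Bool,
      bit (gval I B.C₁ B.G₁ z) = ε * bit (gval I B.C₂ B.G₂ z) + ∑ v ∈ B.C₁.filter (fun v => v ∈ privs I B.N), bit (z v) + κ := by
  classical
  -- on `Z(q)` the reader's state-free part is a constant
  have hZ : ∀ a, free I B.y (B.J₀ \ B.N) B.N B.T₂ B.C₂ B.G₂ a + bit B.b₂ = 0 → free I B.y (B.J₀ \ B.N) B.N B.T₁ B.C₁ B.G₁ a =
      bit B.b₁ + ∑ e ∈ B.N, ((if I.vars e 2 ∈ B.C₁ then (1 : ZMod 2) else 0) + (if I.vars e 3 ∈ B.C₁ then 1 else 0)) + 1 := fun a ha =>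
    free₁_of_forced I hI hT hW hL hun hblind hT3 ((zmod2_add_eq_zero_iff _ _).1 ha) fun e he => hforced e he a ((zmod2_add_eq_zero_iff _ _).1 ha)
  -- the evaluation identities
  have E1 : ∀ z : Fin n → Bool, bit (gval I B.C₁ B.G₁ z) = free I B.y (B.J₀ \ B.N) B.N B.T₁ B.C₁ B.G₁ (fun v => bit (z v))
      + ∑ v ∈ B.C₁.filter (fun v => v ∈ xverts I (B.J₀ \ B.N)), bit (z v) + ∑ v ∈ B.C₁.filter (fun v => v ∈ privs I B.N), bit (z v)
      + ∑ j ∈ B.T₁, (bit (B.y j) + bit (z (I.vars j 2)) * bit (z (I.vars j 3))) := fun z =>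
    bit_gval_split I hT B.y (B.J₀ \ B.N) B.N B.T₁ B.C₁ B.G₁ (nopriv_of_hun I fun v hv => (hun v hv).1) z
  have E2 : ∀ z : Fin n → Bool, bit (gval I B.C₂ B.G₂ z) = free I B.y (B.J₀ \ B.N) B.N B.T₂ B.C₂ B.G₂ (fun v => bit (z v))
      + ∑ v ∈ B.C₂.filter (fun v => v ∈ xverts I (B.J₀ \ B.N)), bit (z v) + ∑ v ∈ B.C₂.filter (fun v => v ∈ privs I B.N), bit (z v)
      + ∑ j ∈ B.T₂, (bit (B.y j) + bit (z (I.vars j 2)) * bit (z (I.vars j 3))) := fun z =>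
    bit_gval_split I hT B.y (B.J₀ \ B.N) B.N B.T₂ B.C₂ B.G₂ (nopriv_of_hun I fun v hv => (hun v hv).2) z
  have hPR₂ : ∀ z : Fin n → Bool, ∑ v ∈ B.C₂.filter (fun v => v ∈ privs I B.N), bit (z v) = 0 := fun z =>
    sum_eq_zero fun v hv => (hblind v (mem_filter.1 hv).2 (mem_filter.1 hv).1).elim
  have XV1 : ∀ z : Fin n → Bool, ∑ v ∈ B.C₁.filter (fun v => v ∈ xverts I (B.J₀ \ B.N)), bit (z v) =
      ∑ j ∈ B.T₁, (bit (z (I.vars j 0)) + bit (z (I.vars j 1))) := fun z => sum_xverts_eq_pair_sum I hW.hjoin₁ fun v => bit (z v)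
  have XV2 : ∀ z : Fin n → Bool, ∑ v ∈ B.C₂.filter (fun v => v ∈ xverts I (B.J₀ \ B.N)), bit (z v) =
      ∑ j ∈ B.T₂, (bit (z (I.vars j 0)) + bit (z (I.vars j 1))) := fun z => sum_xverts_eq_pair_sum I hW.hjoin₂ fun v => bit (z v)
  -- the polar forms are polar forms of ONE output family each
  have hdis₁ : Disjoint B.T₁ (freeMon I B.N B.G₁) := (hG₁.symm.mono_left (hW.hT₁.trans sdiff_subset)).mono_right (freeMon_subset I B.N B.G₁)
  have hdis₂ : Disjoint B.T₂ (freeMon I B.N B.G₂) := (hG₂.symm.mono_left (hW.hT₂.trans sdiff_subset)).mono_right (freeMon_subset I B.N B.G₂)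
  rcases forcing_of_kernel_trivial (q := fun x => free I B.y (B.J₀ \ B.N) B.N B.T₂ B.C₂ B.G₂ x + bit B.b₂)
      (f := free I B.y (B.J₀ \ B.N) B.N B.T₁ B.C₁ B.G₁) hK ⟨_, free_add I B.y (B.J₀ \ B.N) B.N B.T₁ B.C₁ B.G₁⟩ hZ with hc | ⟨κ, hκ⟩
  · -- a CONSTANT reader: polar form zero, so `T₁ = ∅`
    have h0 : ∀ x w, free I B.y (B.J₀ \ B.N) B.N B.T₁ B.C₁ B.G₁ (x + w) =
        free I B.y (B.J₀ \ B.N) B.N B.T₁ B.C₁ B.G₁ x + free I B.y (B.J₀ \ B.N) B.N B.T₁ B.C₁ B.G₁ w + free I B.y (B.J₀ \ B.N) B.N B.T₁ B.C₁ B.G₁ 0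
          + (polar (∅ : Finset (Fin m)) (fun j => I.vars j 2) (fun j => I.vars j 3) : LinearMap.BilinForm (ZMod 2) (Fin n → ZMod 2)) x w := by
      intro x w
      rw [hc, hc, hc, hc, polar_apply, sum_empty]
      generalize bit B.b₁ + ∑ e ∈ B.N, ((if I.vars e 2 ∈ B.C₁ then (1 : ZMod 2) else 0) + (if I.vars e 3 ∈ B.C₁ then 1 else 0)) + 1 = t
      revert t; decide
    have hpol := polar_unique (free_add I B.y (B.J₀ \ B.N) B.N B.T₁ B.C₁ B.G₁) h0
    rw [freePolar_eq_polar_union I hdis₁] at hpol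
    have hE := eq_of_polar_eq I hI hS hpol
    have hT₁ : B.T₁ = ∅ := subset_empty.1 (hE ▸ subset_union_left)
    refine ⟨0, bit B.b₁ + ∑ e ∈ B.N, ((if I.vars e 2 ∈ B.C₁ then (1 : ZMod 2) else 0) + (if I.vars e 3 ∈ B.C₁ then 1 else 0)) + 1, fun z => ?_⟩
    rw [E1 z, XV1 z, hc, hT₁, sum_empty, sum_empty, zero_mul]
    ring
  · -- a `q`-reader: the same polar form as `w₂`, so `T₁ = T₂`
    have hκ' : ∀ x, free I B.y (B.J₀ \ B.N) B.N B.T₁ B.C₁ B.G₁ x = free I B.y (B.J₀ \ B.N) B.N B.T₂ B.C₂ B.G₂ x + bit B.b₂ + κ := fun x => hκ x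
    have h1 : ∀ x w, free I B.y (B.J₀ \ B.N) B.N B.T₁ B.C₁ B.G₁ (x + w) =
        free I B.y (B.J₀ \ B.N) B.N B.T₁ B.C₁ B.G₁ x + free I B.y (B.J₀ \ B.N) B.N B.T₁ B.C₁ B.G₁ w + free I B.y (B.J₀ \ B.N) B.N B.T₁ B.C₁ B.G₁ 0
          + freePolar I B.N B.T₂ B.G₂ x w := by
      intro x w
      rw [hκ', hκ', hκ', hκ', q_polar I B x w]
      linear_combination (-1 : ZMod 2) * zmod2_add_self κ
    have hpol := polar_unique (free_add I B.y (B.J₀ \ B.N) B.N B.T₁ B.C₁ B.G₁) h1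
    rw [freePolar_eq_polar_union I hdis₁, freePolar_eq_polar_union I hdis₂] at hpol
    have hE := eq_of_polar_eq I hI hS hpol
    have hT₁₂ : B.T₁ = B.T₂ := eq_of_union_eq (hW.hT₁.trans sdiff_subset) (hW.hT₂.trans sdiff_subset)
      (hG₁.mono_left (freeMon_subset I B.N B.G₁)) (hG₂.mono_left (freeMon_subset I B.N B.G₂)) hE
    refine ⟨1, κ + bit B.b₂, fun z => ?_⟩
    rw [E1 z, E2 z, XV1 z, XV2 z, hPR₂ z, hκ', hT₁₂, one_mul]
    ring

/-! ## The shape of `w₂` next to an (EQ) chord -/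

/-- **`w₂` next to an (EQ) chord `c₀`:** `T₂ = D c₀` and `w₂(z) = K + z_{u(c₀)} + z_{v(c₀)}` at every assignment `z`. -/
theorem w₂_shape (I : LocalMap 4 n m) (hI : I.IsPure xorAndPred) (hT : Typed I) (hS : SimpleOverlap I) {B : BridgeData n m} (hW : B.WF I)
    (hG₂ : Disjoint B.G₂ B.J₀) (hun₂ : ∀ v ∈ privs I B.N, ∀ g ∈ B.G₂, I.vars g 2 ≠ v ∧ I.vars g 3 ≠ v) (hblind : ∀ v ∈ privs I B.N, v ∉ B.C₂)
    {c₀ : Fin m} (hc₀ : c₀ ∈ B.N) {κ₀ : ZMod 2}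
    (hκ₀ : ∀ x, qform (B.D c₀) (fun j => I.vars j 2) (fun j => I.vars j 3) x = free I B.y (B.J₀ \ B.N) B.N B.T₂ B.C₂ B.G₂ x + bit B.b₂ + κ₀) :
    ∃ K : ZMod 2, ∀ z : Fin n → Bool, bit (gval I B.C₂ B.G₂ z) = K + bit (z (I.vars c₀ 0)) + bit (z (I.vars c₀ 1)) := by
  classical
  -- `T₂ = D c₀` by polar comparison
  have hdis₂ : Disjoint B.T₂ (freeMon I B.N B.G₂) := (hG₂.symm.mono_left (hW.hT₂.trans sdiff_subset)).mono_right (freeMon_subset I B.N B.G₂)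
  have h1 : ∀ x w, qform (B.D c₀) (fun j => I.vars j 2) (fun j => I.vars j 3) (x + w) =
      qform (B.D c₀) (fun j => I.vars j 2) (fun j => I.vars j 3) x + qform (B.D c₀) (fun j => I.vars j 2) (fun j => I.vars j 3) w
        + qform (B.D c₀) (fun j => I.vars j 2) (fun j => I.vars j 3) 0 + freePolar I B.N B.T₂ B.G₂ x w := by
    intro x w
    rw [hκ₀, hκ₀, hκ₀, hκ₀, q_polar I B x w]
    linear_combination (-1 : ZMod 2) * zmod2_add_self κ₀
  have hpol := polar_unique (qform_add' I (B.D c₀)) h1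
  rw [freePolar_eq_polar_union I hdis₂] at hpol
  have hE := eq_of_polar_eq I hI hS hpol
  have hT₂ : B.T₂ = B.D c₀ :=
    (eq_of_union_eq (T := B.D c₀) (A := ∅) ((hW.hD c₀ hc₀).trans sdiff_subset) (hW.hT₂.trans sdiff_subset) (disjoint_empty_left _)
      (hG₂.mono_left (freeMon_subset I B.N B.G₂)) (by rw [union_empty]; exact hE)).symm
  have heD : c₀ ∉ B.D c₀ := fun h => (mem_sdiff.1 (hW.hD c₀ hc₀ h)).2 hc₀
  have hfree : ∀ x, free I B.y (B.J₀ \ B.N) B.N B.T₂ B.C₂ B.G₂ x =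
      qform (B.D c₀) (fun j => I.vars j 2) (fun j => I.vars j 3) x + bit B.b₂ + κ₀ := fun x => by
    linear_combination (-1 : ZMod 2) * hκ₀ x - zmod2_add_self (bit B.b₂) - zmod2_add_self κ₀
  refine ⟨κ₀ + bit B.b₂ + ∑ j ∈ B.D c₀, bit (B.y j), fun z => ?_⟩
  rw [bit_gval_split I hT B.y (B.J₀ \ B.N) B.N B.T₂ B.C₂ B.G₂ (nopriv_of_hun I hun₂) z, sum_xverts_eq_pair_sum I hW.hjoin₂ fun v => bit (z v),
    sum_eq_zero fun v hv => (hblind v (mem_filter.1 hv).2 (mem_filter.1 hv).1).elim, hfree, hT₂,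
    ← pair_eq_sum_of_even_insert heD (hW.hDeven c₀ hc₀) fun v => bit (z v)]
  have hJS : ∑ j ∈ B.D c₀, (bit (B.y j) + bit (z (I.vars j 2)) * bit (z (I.vars j 3))) =
      ∑ j ∈ B.D c₀, bit (B.y j) + qform (B.D c₀) (fun j => I.vars j 2) (fun j => I.vars j 3) (fun v => bit (z v)) := by
    simp only [qform, sum_add_distrib]
  rw [hJS]
  linear_combination zmod2_add_self (qform (B.D c₀) (fun j => I.vars j 2) (fun j => I.vars j 3) fun v => bit (z v))

/-- **`c₀ ∧ w₂` switches the privates of `c₀` ON**, once calibrated at one assignment where `c₀`, `w₂` hold and the privates are ON. -/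
theorem privs_on (I : LocalMap 4 n m) (hI : I.IsPure xorAndPred) {y : Fin m → Bool} {C₂ : Finset (Fin n)} {G₂ : Finset (Fin m)} {b₂ : Bool}
    {c₀ : Fin m} {K : ZMod 2} (hK : ∀ z : Fin n → Bool, bit (gval I C₂ G₂ z) = K + bit (z (I.vars c₀ 0)) + bit (z (I.vars c₀ 1)))
    {z₀ : Fin n → Bool} (hz₀c : I.eval z₀ c₀ = y c₀) (hz₀w : gval I C₂ G₂ z₀ = b₂) (hz₀2 : z₀ (I.vars c₀ 2) = true) (hz₀3 : z₀ (I.vars c₀ 3) = true)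
    {z : Fin n → Bool} (hzc : I.eval z c₀ = y c₀) (hzw : gval I C₂ G₂ z = b₂) :
    z (I.vars c₀ 2) = true ∧ z (I.vars c₀ 3) = true := by
  have e0 := pair_eq_of_eval I hI hz₀c
  have e1 := pair_eq_of_eval I hI hzc
  have k0 := hK z₀
  have k1 := hK z
  rw [hz₀w, add_assoc] at k0
  rw [hzw, add_assoc, k0] at k1
  rw [hz₀2, hz₀3] at e0
  have canc : ∀ K s t : ZMod 2, K + s = K + t → s = t := by decide
  have hs := canc _ _ _ k1
  rw [e0, e1] at hs
  have hprod : bit (z (I.vars c₀ 2)) * bit (z (I.vars c₀ 3)) = bit true * bit true := canc _ _ _ hs.symm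
  revert hprod
  cases z (I.vars c₀ 2) <;> cases z (I.vars c₀ 3) <;> decide

/-! ## STEP 1: rank six is empty -/

/-- **The release contradiction.**  A reader of shape `ε·w₂ + (private reads) + κ` takes the same value at any two assignments satisfying `w₂` with all privates
ON; so it cannot hit its target at one and miss it at the other. -/
theorem false_of_release (I : LocalMap 4 n m) {N : Finset (Fin m)} {C₁ C₂ : Finset (Fin n)} {G₁ G₂ : Finset (Fin m)} {b₁ b₂ : Bool} {ε κ : ZMod 2}
    (hA : ∀ z : Fin n → Bool, bit (gval I C₁ G₁ z) = ε * bit (gval I C₂ G₂ z) + ∑ v ∈ C₁.filter (fun v => v ∈ privs I N), bit (z v) + κ)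
    {z₀ z : Fin n → Bool} (hz₀w : gval I C₂ G₂ z₀ = b₂) (hz₀p : ∀ v ∈ privs I N, z₀ v = true) (hz₀A : gval I C₁ G₁ z₀ ≠ b₁)
    (hzw : gval I C₂ G₂ z = b₂) (hzp : ∀ v ∈ privs I N, z v = true) (hzA : gval I C₁ G₁ z = b₁) : False := by
  apply hz₀A
  rw [← hzA]
  apply bit_injective
  rw [hA z₀, hA z, hz₀w, hzw]
  congr 2
  exact sum_congr rfl fun v hv => by rw [hz₀p v (mem_filter.1 hv).2, hzp v (mem_filter.1 hv).2]

/-- **CASE A IS EMPTY WHEN THE KERNEL OF `q` IS TRIVIAL.**  Pure typed instance with simple overlaps; well-formed liftable bridge data `B` (reader `A₀ = (C₁, G₁, b₁)`,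
shared constraint `w₂ = (C₂, G₂, b₂)`, monomial sets disjoint from the core, `J₀ ≠ ∅`); a second reader `A₁ = (C₁′, G₁, b₁′)` whose linear part agrees with `C₁` on the
XOR vertices of the forest; hun (no monomial touches a chord private); Case A (`w₂` does not read the privates); (T3) for both pairs; the union cover (M0′).  If the second
constraint `q = free₂ + b₂` has a zero and TRIVIAL KERNEL — every quadratic vanishing on `Z(q)` is `0` or `q` — there is no such configuration.  (Planner p3 g22's form,
STATUS 19:54:21Z / 19:59:12Z: kernel triviality holds in rank `≥ 6`, for hyperbolic rank four, for graph types and for `q = μ₁μ₂`.) -/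
theorem caseA_empty_of_kernel_trivial (I : LocalMap 4 n m) (hI : I.IsPure xorAndPred) (hT : Typed I) (hS : SimpleOverlap I) {B : BridgeData n m}
    (hW : B.WF I) (hL : Lift I B) (hG₁ : Disjoint B.G₁ B.J₀) (hG₂ : Disjoint B.G₂ B.J₀) (hJ : B.J₀.Nonempty)
    {C₁' : Finset (Fin n)} {b₁' : Bool} (hC : ∀ v ∈ B.C₁ ∆ C₁', v ∉ xverts I (B.J₀ \ B.N))
    (hun : ∀ v ∈ privs I B.N, (∀ g ∈ B.G₁, I.vars g 2 ≠ v ∧ I.vars g 3 ≠ v) ∧ ∀ g ∈ B.G₂, I.vars g 2 ≠ v ∧ I.vars g 3 ≠ v)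
    (hblind : ∀ v ∈ privs I B.N, v ∉ B.C₂)
    (hT3 : ¬ ∃ z, Solution I B B.J₀ z) (hT3' : ¬ ∃ z, Solution I { B with C₁ := C₁', b₁ := b₁' } B.J₀ z)
    (hM0 : ∀ f ∈ B.J₀, (∃ z, Solution I B (B.J₀.erase f) z) ∨ (∃ z, Solution I { B with C₁ := C₁', b₁ := b₁' } (B.J₀.erase f) z))
    (hZ : ∃ a, free I B.y (B.J₀ \ B.N) B.N B.T₂ B.C₂ B.G₂ a = bit B.b₂)
    (hK : ∀ g : (Fin n → ZMod 2) → ZMod 2, IsQuadFn g → (∀ x, free I B.y (B.J₀ \ B.N) B.N B.T₂ B.C₂ B.G₂ x + bit B.b₂ = 0 → g x = 0) →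
      (∀ x, g x = 0) ∨ (∀ x, g x = free I B.y (B.J₀ \ B.N) B.N B.T₂ B.C₂ B.G₂ x + bit B.b₂)) : False := by
  classical
  have hW' : ({ B with C₁ := C₁', b₁ := b₁' } : BridgeData n m).WF I := wf_update hW b₁' hC
  -- (★★): every chord is forced on `Z(q)`
  have hforced : ∀ e ∈ B.N, ∀ a, free I B.y (B.J₀ \ B.N) B.N B.T₂ B.C₂ B.G₂ a = bit B.b₂ → uval I B.y (B.D e) e a = 1 :=
    fun e he a ha => forced_of_cover I hI hT hW hL hC hun hblind hT3 hT3' hM0 he ha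
  -- a genuine solution of `J₀ ∧ w₂` with all privates ON
  obtain ⟨a, ha⟩ := hZ
  obtain ⟨z₀, hz₀J, hz₀w, hz₀p, -⟩ := exists_solution_privs I hI hT hW hL hun hblind hforced ha
  -- the two readers' shapes
  obtain ⟨ε₀, κ₀, hA₀⟩ := reader_shape I hI hT hS hW hL hG₁ hG₂ hun hblind hT3 hforced hK
  obtain ⟨ε₁, κ₁, hA₁⟩ : ∃ ε κ : ZMod 2, ∀ z : Fin n → Bool,
      bit (gval I C₁' B.G₁ z) = ε * bit (gval I B.C₂ B.G₂ z) + ∑ v ∈ C₁'.filter (fun v => v ∈ privs I B.N), bit (z v) + κ :=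
    reader_shape I hI hT hS hW' hL hG₁ hG₂ hun hblind hT3' hforced hK
  -- wherever the chords and `w₂` hold, the privates are ON
  have hpriv : ∀ z : Fin n → Bool, (∀ e ∈ B.N, I.eval z e = B.y e) → gval I B.C₂ B.G₂ z = B.b₂ → ∀ v ∈ privs I B.N, z v = true := by
    intro z hzN hzw v hv
    obtain ⟨c₀, hc₀, hv⟩ := (mem_privs I).1 hv
    obtain ⟨κ, hκ⟩ := chord_EQ I hI hS hW hforced hK hc₀
    obtain ⟨K, hK'⟩ := w₂_shape I hI hT hS hW hG₂ (fun v hv => (hun v hv).2) hblind hc₀ hκ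
    have h := privs_on I hI hK' (hz₀J c₀ (hW.hN hc₀)) hz₀w (hz₀p _ (vars_mem_privs I hc₀ (s := 2) (by decide)))
      (hz₀p _ (vars_mem_privs I hc₀ (s := 3) (by decide))) (hzN c₀ hc₀) hzw
    rcases hv with h2 | h3
    · rw [← h2]; exact h.1
    · rw [← h3]; exact h.2
  -- a forest output
  obtain ⟨f, hfJ, hfN⟩ : ∃ f ∈ B.J₀, f ∉ B.N := by
    rcases B.N.eq_empty_or_nonempty with hN | ⟨c₀, hc₀⟩
    · obtain ⟨f, hf⟩ := hJ
      exact ⟨f, hf, by rw [hN]; exact notMem_empty f⟩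
    · have heD : c₀ ∉ B.D c₀ := fun h => (mem_sdiff.1 (hW.hD c₀ hc₀ h)).2 hc₀
      have h2 := two_le_card_of_even I hI hS heD (hW.hDeven c₀ hc₀)
      obtain ⟨f, hf⟩ := card_pos.1 (by omega : 0 < (B.D c₀).card)
      exact ⟨f, (mem_sdiff.1 (hW.hD c₀ hc₀ hf)).1, (mem_sdiff.1 (hW.hD c₀ hc₀ hf)).2⟩
  have hNf : ∀ e ∈ B.N, e ∈ B.J₀.erase f := fun e he => mem_erase.2 ⟨fun h => hfN (h ▸ he), hW.hN he⟩
  -- the release witness of `f` gives the released reader its value on `Z` — which misses the target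
  rcases hM0 f hfJ with ⟨z, hzK, hz1, hz2⟩ | ⟨z, hzK, hz1, hz2⟩
  · exact false_of_release I hA₀ hz₀w hz₀p (fun h => hT3 ⟨z₀, hz₀J, h, hz₀w⟩) hz2 (hpriv z (fun e he => hzK e (hNf e he)) hz2) hz1
  · exact false_of_release I hA₁ hz₀w hz₀p (fun h => hT3' ⟨z₀, hz₀J, h, hz₀w⟩) hz2 (hpriv z (fun e he => hzK e (hNf e he)) hz2) hz1

/-- **STEP 1 — RANK-SIX VACUITY OF CASE A.**  The same configuration cannot have `dim rad (freePolar I N T₂ G₂) + 6 ≤ n`: in rank `≥ 6` the kernel is trivial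
(`PstarRankRigidity.eq_zero_or_eq_of_rank_six`) and `q` has a zero (`exists_zero`). -/
theorem caseA_rank_six_empty (I : LocalMap 4 n m) (hI : I.IsPure xorAndPred) (hT : Typed I) (hS : SimpleOverlap I) {B : BridgeData n m} (hW : B.WF I)
    (hL : Lift I B) (hG₁ : Disjoint B.G₁ B.J₀) (hG₂ : Disjoint B.G₂ B.J₀) (hJ : B.J₀.Nonempty)
    {C₁' : Finset (Fin n)} {b₁' : Bool} (hC : ∀ v ∈ B.C₁ ∆ C₁', v ∉ xverts I (B.J₀ \ B.N))
    (hun : ∀ v ∈ privs I B.N, (∀ g ∈ B.G₁, I.vars g 2 ≠ v ∧ I.vars g 3 ≠ v) ∧ ∀ g ∈ B.G₂, I.vars g 2 ≠ v ∧ I.vars g 3 ≠ v)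
    (hblind : ∀ v ∈ privs I B.N, v ∉ B.C₂)
    (hT3 : ¬ ∃ z, Solution I B B.J₀ z) (hT3' : ¬ ∃ z, Solution I { B with C₁ := C₁', b₁ := b₁' } B.J₀ z)
    (hM0 : ∀ f ∈ B.J₀, (∃ z, Solution I B (B.J₀.erase f) z) ∨ (∃ z, Solution I { B with C₁ := C₁', b₁ := b₁' } (B.J₀.erase f) z))
    (hrank : finrank (ZMod 2) (rad (freePolar I B.N B.T₂ B.G₂)) + 6 ≤ finrank (ZMod 2) (Fin n → ZMod 2)) : False :=
  caseA_empty_of_kernel_trivial I hI hT hS hW hL hG₁ hG₂ hJ hC hun hblind hT3 hT3' hM0 (exists_zero I B (le_trans (by omega) hrank))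
    fun _ hg hgZ => eq_zero_or_eq_of_rank_six (q_polar I B) hrank hg hgZ

end Summit.PneNP.PneNP.Theorems.PstarUnionRankSixEmpty
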